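import Summits.CriticalPhenomena.PercolationContinuityZ3.Theses.PercBudgetLadder
import Summits.CriticalPhenomena.PercolationContinuityZ3.Theorems.PinholeClosing.Negative.PinholeClosingBaseline
import Summits.CriticalPhenomena.PercolationContinuityZ3.Theorems.PercBudgetLadderPinholeClosingZeroRung
import Literature.Probability.Percolation.MinOpenCut
import Literature.Probability.Percolation.SequentialProbing
import Literature.Probability.Percolation.BlockConditioning
import Literature.Probability.Percolation.FiniteEnergy
import HarnessLib.Audit

/-!
# Line `pocket-resampling` — skeleton for crux `PercBudgetLadder.PinholeClosing` (stmt-CriticalPhenomena-5249)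

Lead: `prover-line-stmt-CriticalPhenomena-5249-c1-0` (rev 1, 2026-08-16).  Built from ideator 5's
`SketchIdeator5.lean` (card `Ideas/pocket-resampling-liveness-mass.md`), RESHAPED by the lead:

* level `0` of the crux is NOT a stub — it is the landed theorem `Theorems.pinholeClosing_zero`
  (line `halfspace-polarisation`, p91818);
* the lever is cut to what the inequality chain actually uses: per-pocket KILL + Cauchy–Schwarz.
  The liveness IDENTITY `E[D] = P(budget = k+1)` (uniqueness of the tight pocket, submodularity) is
  motivation for the bet, not a link of the chain, and is therefore not registered;
* every registered stub is DEF-FREE (pure tree vocabulary: the route's set-builder, `obs`,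
  `edgeBoundary`, `edgesTouching`, `Set.indicator`), so a worker lands
  `theorem stub_X : <signature verbatim>` in `namespace Summit.CriticalPhenomena.PercolationContinuityZ3.Theorems`
  of a file `Theorems/PercBudgetLadderPinholeClosingPocket<Stub>.lean --supports stmt-CriticalPhenomena-5249`
  and the `sorry` here becomes `Theorems.stub_X`.  The §0 objects are DEFINITIONALLY those terms
  (`stubs_abbrev`).

THE LINE (level `j ≥ 1`; premise budget `j+1` at `m = l n`, conclusion budget `j` at `M = 2 l n`).
A TIGHT `j`-POCKET of `ω` is a minimal admissible vertex set `A` (`box n ⊆ A ⊆ box m ∖ ∂ⁱⁿ box m`)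
with `≤ j+1` open boundary edges ("doors").  It is a LOCAL event of the finite edge set
`T(A) = edgesTouching A`, so conditionally on `ω ∩ T(A)` the rest of the configuration is fresh:
closing the `≤ 6` fresh edges at a door vertex `b` costs `(1 - p_c)^6` and makes `A ∪ {b}` a
`≤ j`-door admissible set of the DOUBLED window, i.e. budget `≤ j` at `(n, 2ln)` (stubs
`doorKill` + `localKill`).  Summing the local bound over all `A` weighs each configuration by its
LIVENESS MASS `D(ω) = Σ_{A tight} P(budget(n,ln) = j+1 exactly | ω on T(A))`, whence
`∫_{bEv j n 2ln} D ≥ (1-p_c)^6 · P(budget(n, ln) = j+1)` (a tight pocket exists on the premise event,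
stub `tightPocketExists`), and Cauchy–Schwarz gives
`P(bEv j n 2ln) ≥ ((1-p_c)^6 P(exact))² / E[D²]`.  THE BET (the one open stub,
`stub_secondMomentLiveness`): `sup_n E[D²] < ∞` at every level `j ≥ 1` and aspect `l`.

Registered stubs: `stub_tightPocketExists` (M), `stub_doorKill` (M, deterministic),
`stub_localKill` (M, generic product-measure lemma), `stub_tightLocal` (S–M), `stub_cauchySchwarz` (S),
`stub_secondMomentLiveness` (OPEN).  Composition `PinholeClosing_of` is sorry-free.
-/

namespace Summit.CriticalPhenomena.PercolationContinuityZ3.Cruxes.PinholeClosing.PocketResampling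

open MeasureTheory Finset
open Literature.Probability.Percolation Literature.Probability.LatticeModels
open Summit.CriticalPhenomena.PercolationContinuityZ3.Theses
open Summit.CriticalPhenomena.PercolationContinuityZ3.Theorems.PinholeClosing.Negative

noncomputable section

/-! ## §0 Objects (definitionally the raw terms of the stubs) -/

/-- The critical bond measure on `ℤ³`. -/
abbrev μc : Measure (BondConfig (Site 3)) := bondPercolation (zdGraph 3) (criticalProbI 3)

/-- Budget-`k` blocked event of `box 3 n → ∂ⁱⁿ box 3 m` (VERBATIM the route's set-builder). -/
def bEv (k n m : ℕ) : Set (BondConfig (Site 3)) :=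
  {ω : BondConfig (Site 3) | ∃ S : Finset (Sym2 (Site 3)), S.card ≤ k ∧ ¬ ∃ x ∈ box 3 n,
    ∃ y ∈ innerBoundary (zdGraph 3) (box 3 m), (ω \ (↑S : Set (Sym2 (Site 3)))) ∈ openConnIn (↑(box 3 m) : Set (Site 3)) x y}

/-- Budget exactly `k+1`. -/
def exactEv (k n m : ℕ) : Set (BondConfig (Site 3)) := bEv (k + 1) n m \ bEv k n m

/-- Open edge-boundary count `c_ω(A)` (doors of `A`). -/
def openBdry (ω : BondConfig (Site 3)) (A : Finset (Site 3)) : ℕ :=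
  (obs ω (edgeBoundary (zdGraph 3) A)).card

/-- Admissible source sets of the window `(n, m)`: contain the source box, avoid the sink sphere. -/
def Admissible (n m : ℕ) (A : Finset (Site 3)) : Prop :=
  box 3 n ⊆ A ∧ A ⊆ box 3 m \ innerBoundary (zdGraph 3) (box 3 m)

/-- `A` is a TIGHT `k`-pocket of `ω`: admissible, `≤ k+1` doors, every admissible proper subset has `≥ k+2`. -/
def IsTightPocket (k n m : ℕ) (ω : BondConfig (Site 3)) (A : Finset (Site 3)) : Prop :=
  Admissible n m A ∧ openBdry ω A ≤ k + 1 ∧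
    ∀ A' : Finset (Site 3), Admissible n m A' → A' ⊂ A → k + 2 ≤ openBdry ω A'

/-- The event "`A` is a tight `k`-pocket". -/
def tightEv (k n m : ℕ) (A : Finset (Site 3)) : Set (BondConfig (Site 3)) :=
  {ω : BondConfig (Site 3) | IsTightPocket k n m ω A}

/-- Revival probability `λ(A, ω) = P(budget = k+1 exactly | ω on T(A))`, written as the probability
that the hybrid "`ω` on `T(A)`, fresh elsewhere" is exactly live. -/
def revival (k n m : ℕ) (A : Finset (Site 3)) (ω : BondConfig (Site 3)) : ℝ :=
  μc.real {ω' : BondConfig (Site 3) | ω' \ (↑(edgesTouching (zdGraph 3) A) : Set (Sym2 (Site 3))) ∪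
    ↑(obs ω (edgesTouching (zdGraph 3) A)) ∈ exactEv k n m}

/-- The summand of the liveness mass at `A`. -/
def summand (k n m : ℕ) (A : Finset (Site 3)) : BondConfig (Site 3) → ℝ :=
  (tightEv k n m A).indicator (revival k n m A)

/-- The LIVENESS MASS `D(ω) = Σ_{A tight} λ(A, ω)`. -/
def livenessMass (k n m : ℕ) (ω : BondConfig (Site 3)) : ℝ :=
  ∑ A ∈ (box 3 m).powerset, summand k n m A ω

/-! ## §1 The registered stubs (DEF-FREE signatures) -/

/-- **Stub 1 (existence of a tight pocket; M).**  On the budget-`(k+1)` event of the window `(n, m)`,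
`n < m`, lattice configurations admit a tight `k`-pocket inside `box m`.  Proof: from the blocking set
`S` (`#S ≤ k+1`) let `A₀ := box n ∪ {v ∈ box m | v is reachable from box n in (ω ∖ S) inside box m}`;
`A₀` is admissible (no crossing ⇒ no sink vertex; `box n ∩ ∂ⁱⁿ box m = ∅` as `n < m`) and every
open boundary edge of `A₀` lies in `S` (else reachability extends), so `openBdry ≤ k+1`; a
cardinality-minimal admissible `A ⊆ box m` with `openBdry ≤ k+1` is tight. -/
theorem stub_tightPocketExists :
    ∀ (k n m : ℕ) (ω : BondConfig (Site 3)), n < m → ω ⊆ (zdGraph 3).edgeSet →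
      ω ∈ {ω : BondConfig (Site 3) | ∃ S : Finset (Sym2 (Site 3)), S.card ≤ k + 1 ∧ ¬ ∃ x ∈ box 3 n,
        ∃ y ∈ innerBoundary (zdGraph 3) (box 3 m), (ω \ (↑S : Set (Sym2 (Site 3)))) ∈ openConnIn (↑(box 3 m) : Set (Site 3)) x y} →
      ∃ A ∈ (box 3 m).powerset,
        (box 3 n ⊆ A ∧ A ⊆ box 3 m \ innerBoundary (zdGraph 3) (box 3 m)) ∧
        (obs ω (edgeBoundary (zdGraph 3) A)).card ≤ k + 1 ∧
        ∀ A' : Finset (Site 3), (box 3 n ⊆ A' ∧ A' ⊆ box 3 m \ innerBoundary (zdGraph 3) (box 3 m)) →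
          A' ⊂ A → k + 2 ≤ (obs ω (edgeBoundary (zdGraph 3) A')).card := by
  sorry

/-- **Stub 2 (door kill; deterministic; M).**  If `A` is a tight `k`-pocket of the lattice configuration
`ω` for the window `(n, m)` and `m < M`, there is a set `F` of `≤ 6` lattice edges NOT touching `A` such
that every lattice configuration agreeing with `ω` on `edgesTouching A` and closed on `F` is budget-`k`
blocked for the window `(n, M)`.  Proof: if `A` has no door, `F := ∅` and `A` itself is a `0`-door
admissible set of `(n, M)` (`box m ⊆ box M ∖ ∂ⁱⁿ box M` as `m < M`); else pick a door `s(a, b)`,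
`a ∈ A`, `b ∉ A`, put `F := edgesTouching {b} ∖ edgesTouching A` (`#edgesTouching {b} = 6`,
`card_neighborFinset_zdGraph_holds`); then `A ∪ {b}` is admissible for `(n, M)` (`b ∈ box m` because
`a ∉ ∂ⁱⁿ box m`) with `≤ k` open boundary edges (the doors of `A` not at `b`; the other edges at `b` are
in `F`), and the CUT PROPERTY (`SketchIdeator5.mem_bEv_of_openBdry_le`: the open boundary of an
admissible set is a blocking set — copy its 30-line proof) gives budget `≤ k`. -/
theorem stub_doorKill :
    ∀ (k n m M : ℕ) (A : Finset (Site 3)) (ω : BondConfig (Site 3)), m < M → ω ⊆ (zdGraph 3).edgeSet →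
      ((box 3 n ⊆ A ∧ A ⊆ box 3 m \ innerBoundary (zdGraph 3) (box 3 m)) ∧
        (obs ω (edgeBoundary (zdGraph 3) A)).card ≤ k + 1 ∧
        ∀ A' : Finset (Site 3), (box 3 n ⊆ A' ∧ A' ⊆ box 3 m \ innerBoundary (zdGraph 3) (box 3 m)) →
          A' ⊂ A → k + 2 ≤ (obs ω (edgeBoundary (zdGraph 3) A')).card) →
      ∃ F : Finset (Sym2 (Site 3)), F.card ≤ 6 ∧ Disjoint F (edgesTouching (zdGraph 3) A) ∧
        ∀ ω'' : BondConfig (Site 3), ω'' ⊆ (zdGraph 3).edgeSet →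
          obs ω'' (edgesTouching (zdGraph 3) A) = obs ω (edgesTouching (zdGraph 3) A) → (∀ e ∈ F, e ∉ ω'') →
          ω'' ∈ {ω : BondConfig (Site 3) | ∃ S : Finset (Sym2 (Site 3)), S.card ≤ k ∧ ¬ ∃ x ∈ box 3 n,
            ∃ y ∈ innerBoundary (zdGraph 3) (box 3 M), (ω \ (↑S : Set (Sym2 (Site 3)))) ∈ openConnIn (↑(box 3 M) : Set (Site 3)) x y} := by
  sorry

/-- **Stub 3 (local kill ⇒ integrated kill; generic product-measure lemma; M).**  Let `T` be a finite
set of lattice edges, `Tt` an event determined by `T` ("the local selection"), `E`, `G` events.  If every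
lattice configuration `ω ∈ Tt` admits `≤ 6` edges off `T` whose closing (keeping `ω` on `T`) forces `G`,
then `(1-p_c)^6 · P(E ∩ Tt) ≤ ∫_G 𝟙_{Tt}(ω) · P{ω' | ω' off T ∪ (ω on T) ∈ E} dP(ω)`.
Proof: both sides are sums over the cylinders `{obs T = ξ}`, `ξ ⊆ T` (the integrand is a function of
`obs ω T`: `DeterminedBy` + `sdiff_union_obs`); on a cylinder inside `Tt`,
`P(G ∩ {obs T = ξ}) ≥ P({obs T = ξ} ∩ {F closed}) = P{obs T = ξ} · P{F closed} ≥ P{obs T = ξ} (1-p_c)^6`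
(`bondPercolation_real_inter_of_disjoint`, `determinedBy_setOf_obs`, `determinedBy_forall_notMem`,
`le_bondPercolation_real_forall_notMem`, a.s. lattice `ae_subset`), and
`P{ω' | ω' ∖ T ∪ ξ ∈ E} · P{obs T = ξ} = P(E ∩ {obs T = ξ})` (same independence; on the cylinder
`ω' ∖ T ∪ ξ = ω'`).  Tools: `integral_finset_sum`, `integral_indicator`, `setIntegral_const`,
`measurableSet_setOf_obs`, `BlockConditioning.integral_comp_obs_eq_sum` as template. -/
theorem stub_localKill :
    ∀ (T : Finset (Sym2 (Site 3))) (Tt E G : Set (BondConfig (Site 3))),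
      (↑T : Set (Sym2 (Site 3))) ⊆ (zdGraph 3).edgeSet →
      DeterminedBy Tt (↑T : Set (Sym2 (Site 3))) → MeasurableSet Tt → MeasurableSet E → MeasurableSet G →
      (∀ ω ∈ Tt, ω ⊆ (zdGraph 3).edgeSet → ∃ F : Finset (Sym2 (Site 3)), F.card ≤ 6 ∧ Disjoint F T ∧
        ∀ ω'' : BondConfig (Site 3), ω'' ⊆ (zdGraph 3).edgeSet → obs ω'' T = obs ω T → (∀ e ∈ F, e ∉ ω'') → ω'' ∈ G) →
      (1 - (criticalProbI 3 : ℝ)) ^ 6 * (bondPercolation (zdGraph 3) (criticalProbI 3)).real (E ∩ Tt) ≤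
        ∫ ω in G, Tt.indicator (fun ω => (bondPercolation (zdGraph 3) (criticalProbI 3)).real
          {ω' : BondConfig (Site 3) | ω' \ (↑T : Set (Sym2 (Site 3))) ∪ ↑(obs ω T) ∈ E}) ω
          ∂(bondPercolation (zdGraph 3) (criticalProbI 3)) := by
  sorry

/-- **Stub 4 (locality and measurability of the pocket objects; S–M).**  The tight-pocket event of `A`
is determined by `edgesTouching A` (all boundary edges of `A` and of its subsets lie there:
`SketchIdeator5.edgeBoundary_subset_edgesTouching_of_subset`; `obs` reads only membership), hence
measurable (`DeterminedBy.measurableSet_of_finset`), and the revival probability is a function of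
`obs ω (edgesTouching A)`, hence measurable (`RevealmentOrthogonality.measurable_comp_obs`). -/
theorem stub_tightLocal :
    ∀ (k n m : ℕ) (A : Finset (Site 3)),
      DeterminedBy {ω : BondConfig (Site 3) |
          (box 3 n ⊆ A ∧ A ⊆ box 3 m \ innerBoundary (zdGraph 3) (box 3 m)) ∧
          (obs ω (edgeBoundary (zdGraph 3) A)).card ≤ k + 1 ∧
          ∀ A' : Finset (Site 3), (box 3 n ⊆ A' ∧ A' ⊆ box 3 m \ innerBoundary (zdGraph 3) (box 3 m)) →
            A' ⊂ A → k + 2 ≤ (obs ω (edgeBoundary (zdGraph 3) A')).card}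
        (↑(edgesTouching (zdGraph 3) A) : Set (Sym2 (Site 3))) ∧
      MeasurableSet {ω : BondConfig (Site 3) |
          (box 3 n ⊆ A ∧ A ⊆ box 3 m \ innerBoundary (zdGraph 3) (box 3 m)) ∧
          (obs ω (edgeBoundary (zdGraph 3) A)).card ≤ k + 1 ∧
          ∀ A' : Finset (Site 3), (box 3 n ⊆ A' ∧ A' ⊆ box 3 m \ innerBoundary (zdGraph 3) (box 3 m)) →
            A' ⊂ A → k + 2 ≤ (obs ω (edgeBoundary (zdGraph 3) A')).card} ∧
      Measurable (fun ω : BondConfig (Site 3) => (bondPercolation (zdGraph 3) (criticalProbI 3)).real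
        {ω' : BondConfig (Site 3) | ω' \ (↑(edgesTouching (zdGraph 3) A) : Set (Sym2 (Site 3))) ∪
          ↑(obs ω (edgesTouching (zdGraph 3) A)) ∈
          {ω : BondConfig (Site 3) | ∃ S : Finset (Sym2 (Site 3)), S.card ≤ k + 1 ∧ ¬ ∃ x ∈ box 3 n,
            ∃ y ∈ innerBoundary (zdGraph 3) (box 3 m), (ω \ (↑S : Set (Sym2 (Site 3)))) ∈ openConnIn (↑(box 3 m) : Set (Site 3)) x y} \
          {ω : BondConfig (Site 3) | ∃ S : Finset (Sym2 (Site 3)), S.card ≤ k ∧ ¬ ∃ x ∈ box 3 n,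
            ∃ y ∈ innerBoundary (zdGraph 3) (box 3 m), (ω \ (↑S : Set (Sym2 (Site 3)))) ∈ openConnIn (↑(box 3 m) : Set (Site 3)) x y}}) := by
  sorry

/-- **Stub 5 (Cauchy–Schwarz; S).**  For a bounded measurable `f ≥ 0` and a measurable set `s`,
`(∫_s f)² ≤ P(s) · ∫ f²` (`∫_s f = ∫ f · 𝟙_s`, Hölder with `p = q = 2`:
`integral_mul_le_Lp_mul_Lq_of_nonneg`, or `inner_mul_le_norm_mul_norm` in `L²`). -/
theorem stub_cauchySchwarz :
    ∀ (f : BondConfig (Site 3) → ℝ) (s : Set (BondConfig (Site 3))) (C : ℝ),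
      MeasurableSet s → Measurable f → (∀ ω, 0 ≤ f ω) → (∀ ω, f ω ≤ C) →
      (∫ ω in s, f ω ∂(bondPercolation (zdGraph 3) (criticalProbI 3))) ^ 2 ≤
        (bondPercolation (zdGraph 3) (criticalProbI 3)).real s *
          ∫ ω, f ω ^ 2 ∂(bondPercolation (zdGraph 3) (criticalProbI 3)) := by
  sorry

/-- **Stub 6 (THE BET — uniform second moment of the liveness mass at every level `j = k+1 ≥ 1`; OPEN).**
For all `k`, `l ≥ 2` there is `K` with `E[D_{k+1}(n, ln)²] ≤ K` for every `n ≥ 1`, where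
`D_{k+1}(ω) = Σ_{A ⊆ box(ln), A tight (k+1)-pocket of ω} P{ω' | (ω' off T(A)) ∪ (ω on T(A)) has budget exactly k+2}`.
Per fixed `n` free (`D ≤ 2^{#box(ln)}`); the content is uniformity in `n`.  Heuristics and numerics:
card §Bet; kit j015366 (level 0: `E[D² | M = 0] ≈ 45/15/9` at `l = 4/6/8`, `max D ≤ 12`). -/
theorem stub_secondMomentLiveness :
    ∀ (k l : ℕ), 2 ≤ l → ∃ K : ℝ, ∀ n : ℕ, 1 ≤ n →
      ∫ ω, (∑ A ∈ (box 3 (l * n)).powerset,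
        {ω : BondConfig (Site 3) |
            (box 3 n ⊆ A ∧ A ⊆ box 3 (l * n) \ innerBoundary (zdGraph 3) (box 3 (l * n))) ∧
            (obs ω (edgeBoundary (zdGraph 3) A)).card ≤ k + 1 + 1 ∧
            ∀ A' : Finset (Site 3), (box 3 n ⊆ A' ∧ A' ⊆ box 3 (l * n) \ innerBoundary (zdGraph 3) (box 3 (l * n))) →
              A' ⊂ A → k + 1 + 2 ≤ (obs ω (edgeBoundary (zdGraph 3) A')).card}.indicator
          (fun ω => (bondPercolation (zdGraph 3) (criticalProbI 3)).real
            {ω' : BondConfig (Site 3) | ω' \ (↑(edgesTouching (zdGraph 3) A) : Set (Sym2 (Site 3))) ∪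
              ↑(obs ω (edgesTouching (zdGraph 3) A)) ∈
              {ω : BondConfig (Site 3) | ∃ S : Finset (Sym2 (Site 3)), S.card ≤ k + 1 + 1 ∧ ¬ ∃ x ∈ box 3 n,
                ∃ y ∈ innerBoundary (zdGraph 3) (box 3 (l * n)), (ω \ (↑S : Set (Sym2 (Site 3)))) ∈ openConnIn (↑(box 3 (l * n)) : Set (Site 3)) x y} \
              {ω : BondConfig (Site 3) | ∃ S : Finset (Sym2 (Site 3)), S.card ≤ k + 1 ∧ ¬ ∃ x ∈ box 3 n,
                ∃ y ∈ innerBoundary (zdGraph 3) (box 3 (l * n)), (ω \ (↑S : Set (Sym2 (Site 3)))) ∈ openConnIn (↑(box 3 (l * n)) : Set (Site 3)) x y}}) ω) ^ 2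
        ∂(bondPercolation (zdGraph 3) (criticalProbI 3)) ≤ K := by
  sorry

/-! ## §2 The stubs over the §0 objects (definitional) -/

/-- Stub 1 over §0. -/
def Stub1 : Prop := ∀ (k n m : ℕ) (ω : BondConfig (Site 3)), n < m → ω ⊆ (zdGraph 3).edgeSet →
  ω ∈ bEv (k + 1) n m → ∃ A ∈ (box 3 m).powerset, IsTightPocket k n m ω A

/-- Stub 2 over §0. -/
def Stub2 : Prop := ∀ (k n m M : ℕ) (A : Finset (Site 3)) (ω : BondConfig (Site 3)), m < M →
  ω ⊆ (zdGraph 3).edgeSet → IsTightPocket k n m ω A →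
    ∃ F : Finset (Sym2 (Site 3)), F.card ≤ 6 ∧ Disjoint F (edgesTouching (zdGraph 3) A) ∧
      ∀ ω'' : BondConfig (Site 3), ω'' ⊆ (zdGraph 3).edgeSet →
        obs ω'' (edgesTouching (zdGraph 3) A) = obs ω (edgesTouching (zdGraph 3) A) → (∀ e ∈ F, e ∉ ω'') →
        ω'' ∈ bEv k n M

/-- Stub 3 over §0 (generic). -/
def Stub3 : Prop := ∀ (T : Finset (Sym2 (Site 3))) (Tt E G : Set (BondConfig (Site 3))),
  (↑T : Set (Sym2 (Site 3))) ⊆ (zdGraph 3).edgeSet →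
  DeterminedBy Tt (↑T : Set (Sym2 (Site 3))) → MeasurableSet Tt → MeasurableSet E → MeasurableSet G →
  (∀ ω ∈ Tt, ω ⊆ (zdGraph 3).edgeSet → ∃ F : Finset (Sym2 (Site 3)), F.card ≤ 6 ∧ Disjoint F T ∧
    ∀ ω'' : BondConfig (Site 3), ω'' ⊆ (zdGraph 3).edgeSet → obs ω'' T = obs ω T → (∀ e ∈ F, e ∉ ω'') → ω'' ∈ G) →
  (1 - (criticalProbI 3 : ℝ)) ^ 6 * μc.real (E ∩ Tt) ≤
    ∫ ω in G, Tt.indicator (fun ω => μc.real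
      {ω' : BondConfig (Site 3) | ω' \ (↑T : Set (Sym2 (Site 3))) ∪ ↑(obs ω T) ∈ E}) ω ∂μc

/-- Stub 4 over §0. -/
def Stub4 : Prop := ∀ (k n m : ℕ) (A : Finset (Site 3)),
  DeterminedBy (tightEv k n m A) (↑(edgesTouching (zdGraph 3) A) : Set (Sym2 (Site 3))) ∧
  MeasurableSet (tightEv k n m A) ∧ Measurable (revival k n m A)

/-- Stub 5 over §0 (generic). -/
def Stub5 : Prop := ∀ (f : BondConfig (Site 3) → ℝ) (s : Set (BondConfig (Site 3))) (C : ℝ),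
  MeasurableSet s → Measurable f → (∀ ω, 0 ≤ f ω) → (∀ ω, f ω ≤ C) →
  (∫ ω in s, f ω ∂μc) ^ 2 ≤ μc.real s * ∫ ω, f ω ^ 2 ∂μc

/-- Stub 6 over §0 (the bet, levels `k+1 ≥ 1`). -/
def Stub6 : Prop := ∀ (k l : ℕ), 2 ≤ l → ∃ K : ℝ, ∀ n : ℕ, 1 ≤ n →
  ∫ ω, (livenessMass (k + 1) n (l * n) ω) ^ 2 ∂μc ≤ K

/-- The registered stubs ARE the abbreviated statements (definitional unfolding of §0). -/
theorem stubs_abbrev : Stub1 ∧ Stub2 ∧ Stub3 ∧ Stub4 ∧ Stub5 ∧ Stub6 :=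
  ⟨stub_tightPocketExists, stub_doorKill, stub_localKill, stub_tightLocal, stub_cauchySchwarz,
    stub_secondMomentLiveness⟩

/-! ## §3 Elementary facts used by the composition (proved) -/

theorem measurableSet_bEv (k n m : ℕ) : MeasurableSet (bEv k n m) := measurableSet_blockedEv k n m

theorem measurableSet_exactEv (k n m : ℕ) : MeasurableSet (exactEv k n m) :=
  (measurableSet_bEv _ n m).diff (measurableSet_bEv k n m)

theorem bEv_mono_budget {k k' : ℕ} (h : k ≤ k') (n m : ℕ) : bEv k n m ⊆ bEv k' n m :=
  blockedEv_mono_budget h n m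

theorem coe_edgesTouching_subset_edgeSet (A : Finset (Site 3)) :
    (↑(edgesTouching (zdGraph 3) A) : Set (Sym2 (Site 3))) ⊆ (zdGraph 3).edgeSet :=
  fun _ he => (mem_edgesTouching_iff.1 (Finset.mem_coe.1 he)).1

theorem revival_nonneg (k n m : ℕ) (A : Finset (Site 3)) (ω : BondConfig (Site 3)) :
    0 ≤ revival k n m A ω := measureReal_nonneg

theorem revival_le_one (k n m : ℕ) (A : Finset (Site 3)) (ω : BondConfig (Site 3)) :
    revival k n m A ω ≤ 1 := measureReal_le_one

theorem summand_nonneg (k n m : ℕ) (A : Finset (Site 3)) (ω : BondConfig (Site 3)) :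
    0 ≤ summand k n m A ω :=
  Set.indicator_nonneg (fun ω _ => revival_nonneg k n m A ω) ω

theorem summand_le_one (k n m : ℕ) (A : Finset (Site 3)) (ω : BondConfig (Site 3)) :
    summand k n m A ω ≤ 1 := by
  unfold summand
  by_cases h : ω ∈ tightEv k n m A
  · rw [Set.indicator_of_mem h]; exact revival_le_one k n m A ω
  · rw [Set.indicator_of_notMem h]; exact zero_le_one

theorem livenessMass_nonneg (k n m : ℕ) (ω : BondConfig (Site 3)) : 0 ≤ livenessMass k n m ω :=
  Finset.sum_nonneg fun A _ => summand_nonneg k n m A ω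

theorem livenessMass_le (k n m : ℕ) (ω : BondConfig (Site 3)) :
    livenessMass k n m ω ≤ ((box 3 m).powerset.card : ℝ) := by
  unfold livenessMass
  calc ∑ A ∈ (box 3 m).powerset, summand k n m A ω ≤ ∑ _A ∈ (box 3 m).powerset, (1 : ℝ) :=
        Finset.sum_le_sum fun A _ => summand_le_one k n m A ω
    _ = ((box 3 m).powerset.card : ℝ) := by simp

/-- Measurability of the summand and of the liveness mass (from stub 4). -/
theorem measurable_summand (h4 : Stub4) (k n m : ℕ) (A : Finset (Site 3)) :
    Measurable (summand k n m A) :=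
  (h4 k n m A).2.2.indicator (h4 k n m A).2.1

theorem measurable_livenessMass (h4 : Stub4) (k n m : ℕ) : Measurable (livenessMass k n m) :=
  Finset.measurable_sum _ fun A _ => measurable_summand h4 k n m A

theorem integrable_summand (h4 : Stub4) (k n m : ℕ) (A : Finset (Site 3)) (ν : Measure (BondConfig (Site 3)))
    [IsFiniteMeasure ν] : Integrable (summand k n m A) ν :=
  Integrable.of_bound (measurable_summand h4 k n m A).aestronglyMeasurable 1
    (ae_of_all _ fun ω => by
      rw [Real.norm_eq_abs, abs_of_nonneg (summand_nonneg k n m A ω)]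
      exact summand_le_one k n m A ω)

/-! ## §4 The composition (sorry-free modulo the stubs) -/

/-- **The lever at level `k`** (any `k`; used at `k ≥ 1`): from stubs 1–5 and a second-moment bound `K`
at `(k, n, ln)`, if `P(bEv (k+1) n (ln)) ≥ c` then `P(bEv k n (2ln)) ≥ min (c/2) (((1-p_c)^6 (c/2))² / max K 1)`. -/
theorem level_of_stubs (h1 : Stub1) (h2 : Stub2) (h3 : Stub3) (h4 : Stub4) (h5 : Stub5)
    {k l n : ℕ} {c K : ℝ} (hl : 2 ≤ l) (hn : 1 ≤ n) (hc : 0 < c)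
    (hK : ∫ ω, (livenessMass k n (l * n) ω) ^ 2 ∂μc ≤ K)
    (hprem : c ≤ μc.real (bEv (k + 1) n (l * n))) :
    min (c / 2) (((1 - (criticalProbI 3 : ℝ)) ^ 6 * (c / 2)) ^ 2 / max K 1) ≤ μc.real (bEv k n (2 * l * n)) := by
  set m := l * n with hm
  set M := 2 * l * n with hM
  have hnm : n < m := by rw [hm]; nlinarith
  have hmM : m < M := by rw [hm, hM]; nlinarith
  have hnM : n ≤ M := by omega
  set q : ℝ := (1 - (criticalProbI 3 : ℝ)) ^ 6 with hq
  have hq0 : 0 ≤ q := pow_nonneg (sub_nonneg.2 (criticalProbI 3).2.2) 6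
  by_cases hcase : c / 2 ≤ μc.real (bEv k n m)
  · -- the conclusion already holds at the same shape; aspect monotonicity
    refine (min_le_left _ _).trans (hcase.trans ?_)
    exact blockProb_mono_aspect (k := k) hnm.le hmM.le
  · have hcase' : μc.real (bEv k n m) < c / 2 := not_le.mp hcase
    -- mass of the exact level
    have hexact : c / 2 ≤ μc.real (exactEv k n m) := by
      have hsub : bEv k n m ⊆ bEv (k + 1) n m := bEv_mono_budget (Nat.le_succ k) n m
      have : μc.real (exactEv k n m) = μc.real (bEv (k + 1) n m) - μc.real (bEv k n m) :=
        measureReal_sdiff hsub (measurableSet_bEv k n m)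
      rw [this]; linarith
    -- the integrated kill, summed over pockets
    set G := bEv k n M with hG
    have hGm : MeasurableSet G := measurableSet_bEv k n M
    have hkillA : ∀ A : Finset (Site 3), q * μc.real (exactEv k n m ∩ tightEv k n m A) ≤
        ∫ ω in G, summand k n m A ω ∂μc := by
      intro A
      have hloc := h4 k n m A
      refine h3 (edgesTouching (zdGraph 3) A) (tightEv k n m A) (exactEv k n m) G
        (coe_edgesTouching_subset_edgeSet A) hloc.1 hloc.2.1 (measurableSet_exactEv k n m) hGm ?_
      intro ω hω hωE
      exact h2 k n m M A ω hmM hωE hω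
    have hsum_int : ∫ ω in G, livenessMass k n m ω ∂μc = ∑ A ∈ (box 3 m).powerset, ∫ ω in G, summand k n m A ω ∂μc := by
      unfold livenessMass
      rw [integral_finsetSum]
      exact fun A _ => integrable_summand h4 k n m A _
    have hcover : μc.real (exactEv k n m) ≤ ∑ A ∈ (box 3 m).powerset, μc.real (exactEv k n m ∩ tightEv k n m A) := by
      have hsub : μc.real (exactEv k n m) ≤ μc.real (⋃ A ∈ (box 3 m).powerset, (exactEv k n m ∩ tightEv k n m A)) := by
        refine real_mono_of_lattice fun ω hω hωE => ?_
        obtain ⟨A, hA, htight⟩ := h1 k n m ω hnm hω hωE.1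
        exact Set.mem_biUnion (Finset.mem_coe.2 hA) ⟨hωE, htight⟩
      exact hsub.trans (measureReal_biUnion_finset_le _ _)
    have hkill : q * (c / 2) ≤ ∫ ω in G, livenessMass k n m ω ∂μc := by
      calc q * (c / 2) ≤ q * μc.real (exactEv k n m) := mul_le_mul_of_nonneg_left hexact hq0
        _ ≤ q * ∑ A ∈ (box 3 m).powerset, μc.real (exactEv k n m ∩ tightEv k n m A) :=
            mul_le_mul_of_nonneg_left hcover hq0
        _ = ∑ A ∈ (box 3 m).powerset, q * μc.real (exactEv k n m ∩ tightEv k n m A) := by rw [Finset.mul_sum]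
        _ ≤ ∑ A ∈ (box 3 m).powerset, ∫ ω in G, summand k n m A ω ∂μc := Finset.sum_le_sum fun A _ => hkillA A
        _ = ∫ ω in G, livenessMass k n m ω ∂μc := hsum_int.symm
    -- Cauchy–Schwarz
    have hCS : (∫ ω in G, livenessMass k n m ω ∂μc) ^ 2 ≤ μc.real G * ∫ ω, (livenessMass k n m ω) ^ 2 ∂μc :=
      h5 (livenessMass k n m) G _ hGm (measurable_livenessMass h4 k n m) (livenessMass_nonneg k n m)
        (livenessMass_le k n m)
    have hqc : 0 ≤ q * (c / 2) := mul_nonneg hq0 (by linarith)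
    have hsq : (q * (c / 2)) ^ 2 ≤ μc.real G * max K 1 := by
      calc (q * (c / 2)) ^ 2 ≤ (∫ ω in G, livenessMass k n m ω ∂μc) ^ 2 :=
            pow_le_pow_left₀ hqc hkill 2
        _ ≤ μc.real G * ∫ ω, (livenessMass k n m ω) ^ 2 ∂μc := hCS
        _ ≤ μc.real G * max K 1 :=
            mul_le_mul_of_nonneg_left (hK.trans (le_max_left K 1)) measureReal_nonneg
    have hmax : 0 < max K 1 := lt_of_lt_of_le one_pos (le_max_right K 1)
    refine (min_le_right _ _).trans ?_
    rw [div_le_iff₀ hmax]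
    exact hsq

/-- **Level `k+1 ≥ 1` of the crux from the stubs** (the bet enters through `Stub6 k`). -/
theorem levelSucc_of_stubs (h1 : Stub1) (h2 : Stub2) (h3 : Stub3) (h4 : Stub4) (h5 : Stub5) (h6 : Stub6)
    (k l : ℕ) (c : ℝ) (hl : 2 ≤ l) (hc : 0 < c) :
    ∃ c' : ℝ, 0 < c' ∧ ∀ n : ℕ, 1 ≤ n →
      c ≤ μc.real (bEv (k + 1 + 1) n (l * n)) → c' ≤ μc.real (bEv (k + 1) n (2 * l * n)) := by
  obtain ⟨K, hK⟩ := h6 k l hl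
  refine ⟨min (c / 2) (((1 - (criticalProbI 3 : ℝ)) ^ 6 * (c / 2)) ^ 2 / max K 1), ?_, fun n hn hprem => ?_⟩
  · refine lt_min (by linarith) (div_pos (pow_pos (mul_pos (pow_pos ?_ 6) (by linarith)) 2)
      (lt_of_lt_of_le one_pos (le_max_right K 1)))
    exact sub_pos.2 pc_lt_one
  · exact level_of_stubs h1 h2 h3 h4 h5 hl hn hc (hK n hn) hprem

/-- The crux, restated over `bEv` (definitional). -/
theorem pinholeClosing_iff_bEv :
    PercBudgetLadder.PinholeClosing ↔
      ∀ (k l : ℕ) (c : ℝ), 2 ≤ l → 0 < c → ∃ c' : ℝ, 0 < c' ∧ ∀ n : ℕ, 1 ≤ n →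
        c ≤ μc.real (bEv (k + 1) n (l * n)) → c' ≤ μc.real (bEv k n (2 * l * n)) :=
  Iff.rfl

/-- **The composition, arrow form**: the six stub STATEMENTS imply the crux (`bEv` form).  Level `0` is
the landed theorem `Theorems.pinholeClosing_zero`; level `k+1` is `levelSucc_of_stubs`. -/
theorem PinholeClosing_of_stubs (h1 : Stub1) (h2 : Stub2) (h3 : Stub3) (h4 : Stub4) (h5 : Stub5) (h6 : Stub6) :
    ∀ (k l : ℕ) (c : ℝ), 2 ≤ l → 0 < c → ∃ c' : ℝ, 0 < c' ∧ ∀ n : ℕ, 1 ≤ n →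
      c ≤ μc.real (bEv (k + 1) n (l * n)) → c' ≤ μc.real (bEv k n (2 * l * n)) := by
  intro k l c hl hc
  cases k with
  | zero => exact Theorems.pinholeClosing_zero l c hl hc
  | succ j => exact levelSucc_of_stubs h1 h2 h3 h4 h5 h6 j l c hl hc

/-- **The skeleton theorem**: the crux `PercBudgetLadder.PinholeClosing` BY NAME, from the registered
stubs (sorries live only inside `stub_*`). -/
theorem PinholeClosing_of : PercBudgetLadder.PinholeClosing :=
  pinholeClosing_iff_bEv.2
    (PinholeClosing_of_stubs stub_tightPocketExists stub_doorKill stub_localKill stub_tightLocal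
      stub_cauchySchwarz stub_secondMomentLiveness)

end

end Summit.CriticalPhenomena.PercolationContinuityZ3.Cruxes.PinholeClosing.PocketResampling
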